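import Literature.Analysis.FluidPDE.PineauVicolLerayPressure
import Literature.Analysis.FluidPDE.PineauVicolCylinderRegularity
import HarnessLib

/-!
# Route CorkscrewDynamo · crux `CorkscrewProfile` (stmt-NavierStokesRegularity-11282) — tool stub T9: quartic growth of the pressure slice `p(−1,·)` of a classical Type-I solution

Tool stub `stub_typeIPressureGrowth` of line `registered` (skeleton v11, lead c5, wave 2): the
profile pressure of the lifted Liouville theorem for rotated self-similar fields is the slice
`p(−1,·)` of the physical pressure of a classical Type-I solution `(u, p)` of Navier–Stokes
(`ν = 1`, `f = 0`) on `(−∞, 0)`, `|u(x,t)| ≤ C₀/(|x| + √(−t))`, and the Liouville lemma needs it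
polynomially bounded. Pineau–Vicol 2026, Lemma 7.1 (all inputs proved in the tree's discharge
files): the derivative bounds `exists_forall_iteratedFDeriv_le_of_typeI` give `‖Dᵏu(−1)‖ ≤ K_d`
(`k ≤ 3`), hence `‖∇(∂ᵢ∂ⱼ(uᵢuⱼ))(−1)‖ ≤ 12K_d²` (`norm_fderiv_pressureSource_le`) and
`‖∇Q[u(−1)](x)‖ ≤ K_Q(12K_d² + C₀²(2+|x|)³)` (`exists_bound_fderiv_pressurePotential`); the
identification `∇p(−1) = ∇Q[u(−1)]` (`gradient_pressure_eq_of_typeI_vertex`) and the mean value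
inequality on `B̄(0, |x|)` give `|p(−1,x) − p(−1,0)| ≤ A(1+|x|)⁴`.
-/

noncomputable section

open MeasureTheory Set Function Filter Topology InnerProductSpace Metric
open Literature.Analysis.FluidPDE Literature.Analysis.FluidPDE.PineauVicol2026
open scoped RealInnerProductSpace Laplacian ContDiff NNReal ENNReal

namespace Summit.NavierStokesRegularity.NavierStokesRegularity.Theorems.CorkscrewProfile.Birth

set_option linter.dupNamespace false

-- nested operator types
set_option maxSynthPendingDepth 3

/-- **Uniform derivative bounds at `t = −1`** (Pineau–Vicol 2026, Lemma 7.1, (7.2) in physical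
variables): one constant `K_d(C₀) ≥ 0` with `‖Dᵏu(−1)(y)‖ ≤ K_d` for `k ≤ 3` and every classical
Type-I solution of constant `C₀` on `(−∞, 0)` (`exists_forall_iteratedFDeriv_le_of_typeI` for
`n = 0, 1, 2, 3` at `t = −1`, where `max{|y|, √1} ≥ 1`). [cite: PineauVicol2026, Lemma 7.1] -/
theorem typeIPressureGrowth_derivs (C₀ : ℝ) : ∃ Kd : ℝ, 0 ≤ Kd ∧
    ∀ (u : ℝ → EuclideanSpace ℝ (Fin 3) → EuclideanSpace ℝ (Fin 3))
      (p : ℝ → EuclideanSpace ℝ (Fin 3) → ℝ),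
      IsClassicalNSSolutionOn (Iio 0) 1 0 u p →
      (∀ t ∈ Iio (0 : ℝ), ∀ x, ‖u t x‖ ≤ C₀ / (‖x‖ + Real.sqrt (-t))) →
      ∀ k ≤ 3, ∀ y : EuclideanSpace ℝ (Fin 3), ‖iteratedFDeriv ℝ k (u (-1)) y‖ ≤ Kd := by
  obtain ⟨K₀, hK₀0, hK₀⟩ := exists_forall_iteratedFDeriv_le_of_typeI 0 C₀
  obtain ⟨K₁, hK₁0, hK₁⟩ := exists_forall_iteratedFDeriv_le_of_typeI 1 C₀
  obtain ⟨K₂, hK₂0, hK₂⟩ := exists_forall_iteratedFDeriv_le_of_typeI 2 C₀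
  obtain ⟨K₃, hK₃0, hK₃⟩ := exists_forall_iteratedFDeriv_le_of_typeI 3 C₀
  refine ⟨K₀ + K₁ + K₂ + K₃, by positivity, fun u p hsol hI k hk y => ?_⟩
  have h1 : (-1 : ℝ) ∈ Iio (0 : ℝ) := by norm_num
  have hs1 : Real.sqrt (-(-1 : ℝ)) = 1 := by rw [neg_neg, Real.sqrt_one]
  have e0 := hK₀ u p hsol hI (-1) h1 y
  have e1 := hK₁ u p hsol hI (-1) h1 y
  have e2 := hK₂ u p hsol hI (-1) h1 y
  have e3 := hK₃ u p hsol hI (-1) h1 y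
  rw [hs1] at e0 e1 e2 e3
  have hm1 : (max ‖y‖ 1)⁻¹ ≤ 1 := inv_le_one_of_one_le₀ (le_max_right _ _)
  have hmk : ∀ n : ℕ, ((max ‖y‖ 1)⁻¹) ^ n ≤ 1 := fun n => pow_le_one₀ (by positivity) hm1
  interval_cases k
  · exact e0.trans ((mul_le_of_le_one_right hK₀0 (hmk _)).trans (by linarith))
  · exact e1.trans ((mul_le_of_le_one_right hK₁0 (hmk _)).trans (by linarith))
  · exact e2.trans ((mul_le_of_le_one_right hK₂0 (hmk _)).trans (by linarith))
  · exact e3.trans ((mul_le_of_le_one_right hK₃0 (hmk _)).trans (by linarith))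

/-- **`∇p(−1) = ∇Q[u(−1)]`** for a classical Type-I solution on `(−∞, 0)`: the parabolic-vertex
identification `gradient_pressure_eq_of_typeI_vertex` with vertex `(T, x₀) = (0, 0)` at `t = −1`.
[cite: PineauVicol2026, Lemma 7.1 (proof, p. 24)] -/
theorem typeIPressureGrowth_gradient_eq {C₀ : ℝ}
    {u : ℝ → EuclideanSpace ℝ (Fin 3) → EuclideanSpace ℝ (Fin 3)} {p : ℝ → EuclideanSpace ℝ (Fin 3) → ℝ}
    (hsol : IsClassicalNSSolutionOn (Set.Iio 0) 1 0 u p)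
    (hI : ∀ t ∈ Set.Iio (0 : ℝ), ∀ x : EuclideanSpace ℝ (Fin 3), ‖u t x‖ ≤ C₀ / (‖x‖ + Real.sqrt (-t)))
    (x : EuclideanSpace ℝ (Fin 3)) :
    gradient (p (-1)) x = gradient (pressurePotential (u (-1))) x := by
  have hI' : ∀ t ∈ Set.Iio (0 : ℝ), ∀ z : EuclideanSpace ℝ (Fin 3),
      ‖u t z‖ ≤ C₀ / (‖z - 0‖ + Real.sqrt (0 - t)) := fun t ht z => by
    rw [sub_zero, zero_sub]
    exact hI t ht z
  exact gradient_pressure_eq_of_typeI_vertex hsol hI' (by norm_num) x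

/-- **Cubic growth of `∇p(−1)`**: one constant `A(C₀) ≥ 0` with `‖dp(−1)(y)‖ ≤ A(1+|y|)³` for
every classical Type-I solution of constant `C₀` on `(−∞, 0)` (`∇p(−1) = ∇Q[u(−1)]`, the
gradient bound for the potential on the decay class `(1+|y|)|u(−1,y)| ≤ C₀` with source gradient
`≤ 12K_d²`). [cite: PineauVicol2026, Lemma 7.1] -/
theorem typeIPressureGrowth_fderiv (C₀ : ℝ) : ∃ A : ℝ, 0 ≤ A ∧
    ∀ (u : ℝ → EuclideanSpace ℝ (Fin 3) → EuclideanSpace ℝ (Fin 3))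
      (p : ℝ → EuclideanSpace ℝ (Fin 3) → ℝ),
      IsClassicalNSSolutionOn (Iio 0) 1 0 u p →
      (∀ t ∈ Iio (0 : ℝ), ∀ x, ‖u t x‖ ≤ C₀ / (‖x‖ + Real.sqrt (-t))) →
      ∀ y : EuclideanSpace ℝ (Fin 3), ‖fderiv ℝ (p (-1)) y‖ ≤ A * (1 + ‖y‖) ^ 3 := by
  obtain ⟨Kd, hKd0, hKd⟩ := typeIPressureGrowth_derivs C₀
  obtain ⟨KQ, hKQ0, hKQ⟩ := exists_bound_fderiv_pressurePotential
  refine ⟨KQ * (12 * Kd ^ 2 + 8 * C₀ ^ 2), by positivity, fun u p hsol hI y => ?_⟩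
  have h1 : (-1 : ℝ) ∈ Iio (0 : ℝ) := by norm_num
  have hs1 : Real.sqrt (-(-1 : ℝ)) = 1 := by rw [neg_neg, Real.sqrt_one]
  have hv3 : ContDiff ℝ 3 (u (-1)) := contDiff_infty.1 (hsol.contDiff_velocity h1) 3
  have hdiv : VectorCalculus.IsDivFree (u (-1)) := hsol.divFree (-1) h1
  have hdec : ∀ z, ‖u (-1) z‖ ≤ C₀ / (1 + ‖z‖) := fun z => by
    have h := hI (-1) h1 z
    rw [hs1, add_comm] at h
    exact h
  have hDk : ∀ k ≤ 3, ∀ z, ‖iteratedFDeriv ℝ k (u (-1)) z‖ ≤ Kd := hKd u p hsol hI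
  have hsrc : ∀ z, ‖fderiv ℝ (pressureSource (u (-1))) z‖ ≤ 12 * Kd ^ 2 :=
    norm_fderiv_pressureSource_le hv3 hdiv hDk
  have hQ := hKQ (u (-1)) C₀ (12 * Kd ^ 2) hv3 hdec (by positivity) hsrc y
  -- the gradient of `p(−1)` is that of the potential
  have hfd : fderiv ℝ (p (-1)) y = fderiv ℝ (pressurePotential (u (-1))) y := by
    have h := typeIPressureGrowth_gradient_eq hsol hI y
    simp only [gradient] at h
    exact (toDual ℝ (EuclideanSpace ℝ (Fin 3))).symm.injective h
  rw [hfd]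
  refine hQ.trans ?_
  have hr := norm_nonneg y
  have e1 : (2 + ‖y‖) ^ 3 ≤ 8 * (1 + ‖y‖) ^ 3 :=
    calc (2 + ‖y‖) ^ 3 ≤ (2 * (1 + ‖y‖)) ^ 3 := pow_le_pow_left₀ (by positivity) (by linarith) 3
      _ = 8 * (1 + ‖y‖) ^ 3 := by ring
  have e2 : (1 : ℝ) ≤ (1 + ‖y‖) ^ 3 := one_le_pow₀ (by linarith)
  have e3 : 12 * Kd ^ 2 ≤ 12 * Kd ^ 2 * (1 + ‖y‖) ^ 3 := le_mul_of_one_le_right (by positivity) e2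
  have e4 : C₀ ^ 2 * (2 + ‖y‖) ^ 3 ≤ C₀ ^ 2 * (8 * (1 + ‖y‖) ^ 3) :=
    mul_le_mul_of_nonneg_left e1 (sq_nonneg _)
  calc KQ * (12 * Kd ^ 2 + C₀ ^ 2 * (2 + ‖y‖) ^ 3)
      ≤ KQ * (12 * Kd ^ 2 * (1 + ‖y‖) ^ 3 + C₀ ^ 2 * (8 * (1 + ‖y‖) ^ 3)) :=
        mul_le_mul_of_nonneg_left (add_le_add e3 e4) hKQ0
    _ = KQ * (12 * Kd ^ 2 + 8 * C₀ ^ 2) * (1 + ‖y‖) ^ 3 := by ring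

/-- **Stub T9 `stub_typeIPressureGrowth` (Pineau–Vicol 2026, Lemma 7.1, physical variables at
`t = −1`).** For a classical solution `(u, p)` of Navier–Stokes (`ν = 1`, `f = 0`) on `(−∞, 0)`
with the Type-I bound `|u(x,t)| ≤ C₀/(|x| + √(−t))`, the pressure slice at `t = −1` grows at
most quartically about the origin: `|p(−1,x) − p(−1,0)| ≤ A(1+|x|)⁴` for some `A`
(`‖∇p(−1)(y)‖ ≤ A(1+|y|)³` from `typeIPressureGrowth_fderiv`, integrated along the segment
`[0, x] ⊆ B̄(0,|x|)` by the mean value inequality, and `|x| ≤ 1 + |x|`). [cite: PineauVicol2026, Lemma 7.1] -/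
theorem stub_typeIPressureGrowth {C₀ : ℝ}
    {u : ℝ → EuclideanSpace ℝ (Fin 3) → EuclideanSpace ℝ (Fin 3)} {p : ℝ → EuclideanSpace ℝ (Fin 3) → ℝ}
    (hsol : IsClassicalNSSolutionOn (Set.Iio 0) 1 0 u p)
    (hI : ∀ t ∈ Set.Iio (0 : ℝ), ∀ x : EuclideanSpace ℝ (Fin 3), ‖u t x‖ ≤ C₀ / (‖x‖ + Real.sqrt (-t))) :
    ∃ A : ℝ, ∀ x : EuclideanSpace ℝ (Fin 3), |p (-1) x - p (-1) 0| ≤ A * (1 + ‖x‖) ^ 4 := by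
  obtain ⟨A, hA0, hA⟩ := typeIPressureGrowth_fderiv C₀
  have h1 : (-1 : ℝ) ∈ Iio (0 : ℝ) := by norm_num
  have hgrad : ∀ z, ‖fderiv ℝ (p (-1)) z‖ ≤ A * (1 + ‖z‖) ^ 3 := hA u p hsol hI
  have hdiff : Differentiable ℝ (p (-1)) := (hsol.contDiff_pressure h1).differentiable (by simp)
  refine ⟨A, fun x => ?_⟩
  have hb : ∀ z ∈ Metric.closedBall (0 : EuclideanSpace ℝ (Fin 3)) ‖x‖,
      ‖fderiv ℝ (p (-1)) z‖ ≤ A * (1 + ‖x‖) ^ 3 := fun z hz => by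
    have hz' : ‖z‖ ≤ ‖x‖ := mem_closedBall_zero_iff.1 hz
    exact (hgrad z).trans (mul_le_mul_of_nonneg_left
      (pow_le_pow_left₀ (by positivity) (by linarith) 3) hA0)
  have key := (convex_closedBall (0 : EuclideanSpace ℝ (Fin 3)) ‖x‖).norm_image_sub_le_of_norm_fderiv_le
    (fun z _ => hdiff z) hb (Metric.mem_closedBall_self (norm_nonneg x))
    (mem_closedBall_zero_iff.2 le_rfl)
  rw [sub_zero, Real.norm_eq_abs] at key
  refine key.trans ?_
  have hx : ‖x‖ ≤ 1 + ‖x‖ := by linarith [norm_nonneg x]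
  calc A * (1 + ‖x‖) ^ 3 * ‖x‖ ≤ A * (1 + ‖x‖) ^ 3 * (1 + ‖x‖) :=
        mul_le_mul_of_nonneg_left hx (by positivity)
    _ = A * (1 + ‖x‖) ^ 4 := by ring

end Summit.NavierStokesRegularity.NavierStokesRegularity.Theorems.CorkscrewProfile.Birth
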